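import Literature.Analysis.FunctionSpaces.TorusScalarTrigPoly
import Literature.Analysis.FunctionSpaces.TorusDerivBounds
import HarnessLib

/-!
# Hamiltonian shear compositions on the torus `T^{2n}` and `ε`-fixed-point instances

Topic `Literature/Dynamics/Hamiltonian`. Definitions with proved API (no named facts); requested
by the `PneNP` route `ArnoldMorseDeficit` (definition item `defn-HamShearComposition`, request
(D4), for its informal crux `ArnoldTorusDictionary`: "`ε`-fixed points of gradient-Feistel
compositions on `T^{2n}` ↔ MORSE-DEFICIT via Chaperon's discrete action functional"), and kept
free of any complexity theory so that it can serve any discrete-Hamiltonian argument.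

A **Hamiltonian shear composition** ("gradient-Feistel circuit") on the phase space
`T^{2n} = T^n × T^n ∋ (x, y)` (`T^n = UnitAddTorus d`, `|d| = n`) is a finite list of rounds,
each of which is one of the two exact Hamiltonian shears
`kick V : (x, y) ↦ (x, y + ∇V(x))` and `drift W : (x, y) ↦ (x + ∇W(y), y)`,
where the potentials `V, W : T^n → ℝ` are **dyadic trigonometric polynomials** — finite sums
`2^{-prec} ∑ₜ Re((aₜ + i bₜ) e_{kₜ}(x))`, `e_k(x) = exp(2πi k·x)`, with `kₜ ∈ ℤ^n`,
`aₜ, bₜ ∈ ℤ` — a purely syntactic, finitely encodable format. These are the building blocks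
of the splitting integrators for separable Hamiltonians `H(p, q) = T(p) + U(q)`: the exact flows
of `H = T(p)` and `H = U(q)` are the shears `(p, q) ↦ (p, q + t ∇T(p))`,
`(p, q) ↦ (p - t ∇U(q), q)` and a general splitting method is any finite composition of them
([HairerWannerLubich2002], §II.5, Example 5.1, (5.4)–(5.6); symplecticity Thm. VI.3.3); with one
kick and one drift per period they are the kicked (standard-map-type) systems, here with a
trigonometric-polynomial kinetic term as well. Each round is generated, *globally and without
any smallness assumption*, by a **generating function of type V** in the sense of
[McDuffSalamon2017], Lemma 9.2.1: with
`S(x₁, y₀) = -V(x₁)` (kick) resp. `S(x₁, y₀) = W(y₀)` (drift) the round `(x₀, y₀) ↦ (x₁, y₁)`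
is exactly the solution of the Hamiltonian difference equations
`x₁ - x₀ = ∂S/∂y (x₁, y₀)`, `y₁ - y₀ = -∂S/∂x (x₁, y₀)` ([McDuffSalamon2017], (9.2.3)), so the
fixed points of a composition of `N` rounds are the critical points of the discrete symplectic
action `Φ(z) = ∑ⱼ (⟨yⱼ, xⱼ₊₁ - xⱼ⟩ - Sⱼ(xⱼ₊₁, yⱼ))` on `N`-periodic sequences
([McDuffSalamon2017], (9.2.4), Lemma 9.2.6, and (11.1.4)–(11.1.5) in the proof of the
Conley–Zehnder theorem, Thm. 11.1.9: every Hamiltonian symplectomorphism of the standard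
`T^{2n}` has `≥ 2n + 1` fixed points, `≥ 2^{2n}` if all are non-degenerate — although the
Lefschetz number is `χ(T^{2n}) = 0`). That theorem is the intended source of TOTALITY of the
search problem below; it is NOT vendored here (a separate cite item of the route), and nothing in
this file asserts the existence of fixed points or of hard instances.

## Main definitions (all `def`/`structure`/`inductive` with bodies; everything stated is proved)

* `TrigTerm d`, `DyadicTrigPoly d` — the syntax; `DyadicTrigPoly.toFun P : UnitAddTorus d → ℝ`
  its value, *defined* as the tree's real trigonometric polynomial
  `Torus.reTrigPoly P.freqs P.coeff` (aggregated coefficient family) and unfolded to the term sum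
  in `toFun_apply`; `partialFun P j` / `gradFun P` the *syntactic* gradient (again a trigonometric
  polynomial, coefficients `2πi kⱼ c_k`), proved equal to the torus derivatives
  `Torus.partialDeriv j P.toFun` / `Torus.gradient P.toFun` of `Literature/Analysis/FunctionSpaces/
  TorusCalculus` (`partialDeriv_toFun`, `gradient_toFun`).
* The **explicit `C^k` bound**: `P.l1Bound = 2^{-prec} ∑ₜ (|aₜ| + |bₜ|)` and
  `P.freqSup = maxₜ ‖kₜ‖_∞` (both read off the syntax) satisfy
  `Torus.HasDerivBounds n P.toFun P.l1Bound (2π P.freqSup)` for every `n`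
  (`hasDerivBounds_toFun`: `‖∂^α V‖_∞ ≤ l1Bound · (2π freqSup)^{|α|}`), with the read-outs
  `|V| ≤ l1Bound`, `|∂ⱼV| ≤ l1Bound (2π freqSup)`, `|∂ᵢ∂ⱼV| ≤ l1Bound (2π freqSup)²`; the general
  statement `hasDerivBounds_reTrigPoly` is recorded for any `Torus.reTrigPoly`.
* `Phase d = UnitAddTorus d × UnitAddTorus d` with its sup (flat) metric; `ShearRound d`
  (`kick V | drift W`), `ShearRound.toMap`, its inverse shear `toEquiv`, continuity, the lift
  `liftMap` to `ℝ^n × ℝ^n` (`(u, v) ↦ (u, v + ∇V(proj u))`, commuting with the covering map and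
  with deck translations: `proj_liftMap`, `liftMap_add_latticeVec`), and the generating function
  `genFun` with the Hamiltonian difference equations `liftMap_fst_sub`, `liftMap_snd_sub`.
* `HamShearComposition d` (a list of rounds), `toMap` = composition in list order (head first),
  `toEquiv`, `toMap_append`, continuity.
* `ArnoldTorusInstance d = (circuit, p)` with accuracy `ε = 2^{-p}`; `dyadicPoint q j`, the grid
  `dyadicGrid q = (2^{-q}ℤ/ℤ)^{2n} ⊆ T^{2n}`; `IsNearFixedPt I z :↔ ‖F z - z‖ ≤ ε` (sup metric of
  `T^{2n}`, i.e. `|F z - z|_∞ ≤ ε` coordinatewise on `ℝ/ℤ`) and the solution predicate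
  `IsSolution I q z :↔ z ∈ dyadicGrid q ∧ IsNearFixedPt I z` at grid resolution `q` (a parameter:
  which `q = poly(instance)` is admissible is for the search-problem statement to fix). Exact
  fixed points are solutions at every accuracy (`isNearFixedPt_of_isFixedPt`).

## Design notes

* Index type `d` (any `Fintype`, `DecidableEq` for derivatives) instead of `Fin n`: free
  generality, matching the tree's torus calculus; encoders specialise to `d = Fin n`.
* The semantics of a round uses the TRUE gradient `Torus.gradient V.toFun` (so "`y + ∇V(x)`" is
  literal); the syntactic gradient enters only through the proved equation `gradient_toFun`, which
  is what an evaluator would implement.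
* Coefficients are Gaussian integers over a common power of two (`prec`) — fixed-point dyadics;
  every dyadic-coefficient trigonometric polynomial has this form. Repeated frequencies in the
  term list are allowed and summed (`coeff`). No `B₂`-program / straight-line variant is provided
  (the request allowed either; trigonometric polynomials keep the maps genuinely smooth and
  Hamiltonian, which is what the Conley–Zehnder theorem needs).
* Junk values: none (`toFun`, `toMap` are total and honest; the empty term list is the zero
  potential, the empty round list the identity map).
* Mathlib (this pin) has `UnitAddTorus`, `UnitAddTorus.mFourier`, `AddCircle`'s quotient norm,
  `Function.IsFixedPt`, but no symplectic/Hamiltonian maps of tori, no standard map, no generating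
  functions of symplectic maps (`lean search --decl` for `Symplectomorph|IsSymplecticMap|
  HamiltonianDiffeo|hamiltonianFlow`, `standardMap|ChirikovMap`: no hits; `generatingFunction`:
  only power-series/probability/QFT senses); the tree has the transversal coordinate shears
  `Torus.shearMap` of `TorusShearKoopman` (one coordinate sheared by a profile of another — a
  different object) and the torus calculus used here.

## References

* D. McDuff, D. Salamon, *Introduction to Symplectic Topology*, 3rd ed., OUP 2017: Lemma 9.2.1
  and (9.2.3) (generating functions of type V, Hamiltonian difference equations), (9.2.4) and
  Lemma 9.2.6 (discrete symplectic action, critical points = fixed points), §11.1 (11.1.4)–(11.1.5)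
  and Thm. 11.1.9 (Conley–Zehnder). [McDuffSalamon2017]
* E. Hairer, C. Lubich, G. Wanner, *Geometric Numerical Integration*, Springer 2002: §II.5
  Example 5.1, (5.4)–(5.6) (shear flows of `T(p)`, `U(q)`; splitting compositions), Thm. VI.3.3
  (symplectic Euler is symplectic). [HairerWannerLubich2002]
* C. Conley, E. Zehnder, *The Birkhoff–Lewis fixed point theorem and a conjecture of
  V. I. Arnold*, Invent. Math. 73 (1983) 33–49, Thm. 1 (the totality source; not vendored here).
-/

noncomputable section

open Literature.Analysis.FunctionSpaces UnitAddTorus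

namespace Literature.Dynamics.Hamiltonian

variable {d : Type*}

/-! ## Dyadic trigonometric polynomials: syntax -/

/-- One **term** of a dyadic trigonometric polynomial on `T^d`: an integer frequency vector
`k ∈ ℤ^d` and a Gaussian-integer numerator `a + b i`, standing for the real mode
`x ↦ Re((a + b i) e_k(x)) = a cos(2π k·x) - b sin(2π k·x)` (before the common scaling
`2^{-prec}` of the polynomial). [folklore] -/
structure TrigTerm (d : Type*) where
  /-- The frequency vector `k ∈ ℤ^d`. -/
  freq : d → ℤ
  /-- Real part `a` of the numerator (cosine amplitude). -/
  re : ℤ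
  /-- Imaginary part `b` of the numerator (minus the sine amplitude). -/
  im : ℤ

namespace TrigTerm

/-- The numerator `a + b i ∈ ℤ[i] ⊂ ℂ` of a term. [folklore] -/
def coeff (t : TrigTerm d) : ℂ := (t.re : ℂ) + (t.im : ℂ) * Complex.I

/-- `‖a + b i‖ ≤ |a| + |b|`. [folklore] -/
theorem norm_coeff_le (t : TrigTerm d) : ‖t.coeff‖ ≤ |(t.re : ℝ)| + |(t.im : ℝ)| := by
  unfold coeff
  refine (norm_add_le _ _).trans ?_
  simp [Complex.norm_intCast, Complex.norm_I]

/-- The sup norm `‖k‖_∞ ∈ ℕ` of the frequency vector of a term. [folklore] -/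
def freqSup [Fintype d] (t : TrigTerm d) : ℕ := Finset.univ.sup fun j => (t.freq j).natAbs

/-- `|kⱼ| ≤ ‖k‖_∞`. [folklore] -/
theorem natAbs_freq_le_freqSup [Fintype d] (t : TrigTerm d) (j : d) :
    (t.freq j).natAbs ≤ t.freqSup :=
  Finset.le_sup (f := fun j => (t.freq j).natAbs) (Finset.mem_univ j)

/-- `|kⱼ| ≤ ‖k‖_∞`, real form. [folklore] -/
theorem abs_freq_le_freqSup [Fintype d] (t : TrigTerm d) (j : d) :
    |((t.freq j : ℤ) : ℝ)| ≤ t.freqSup := by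
  have h : (((t.freq j).natAbs : ℕ) : ℝ) ≤ (t.freqSup : ℝ) := by
    exact_mod_cast t.natAbs_freq_le_freqSup j
  rwa [Nat.cast_natAbs, Int.cast_abs] at h

end TrigTerm

/-- A **dyadic trigonometric polynomial** on `T^d` in fixed-point form: a precision `prec` and
a list of terms, denoting `V(x) = 2^{-prec} ∑ₜ Re((aₜ + bₜ i) e_{kₜ}(x))`
(`DyadicTrigPoly.toFun`, `toFun_apply`). Every trigonometric polynomial with dyadic-rational
real Fourier data has this form; the representation is not unique (repeated frequencies are
summed, `prec` may be padded). [folklore] -/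
structure DyadicTrigPoly (d : Type*) where
  /-- The common dyadic precision: all numerators are divided by `2 ^ prec`. -/
  prec : ℕ
  /-- The list of terms `(kₜ, aₜ, bₜ)`. -/
  terms : List (TrigTerm d)

/-! ### The derivative multipliers `∏ⱼ 2πi kⱼ` (no finiteness needed) -/

/-- The Fourier multiplier of the iterated partial derivative `∂_{l₀} ⋯ ∂_{lₘ}` on the mode
`e_k`: `∏_{j ∈ l} 2πi kⱼ`. [folklore] -/
def derivMultiplier (l : List d) (k : d → ℤ) : ℂ :=
  (l.map fun j => (2 * Real.pi * Complex.I * (k j) : ℂ)).prod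

/-- `‖∏_{j∈l} 2πi kⱼ‖ ≤ (2πK)^{|l|}` when `‖k‖_∞ ≤ K`. [folklore] -/
theorem norm_derivMultiplier_le {K : ℝ} {k : d → ℤ} (hk : ∀ j, |(k j : ℝ)| ≤ K) (l : List d) :
    ‖derivMultiplier l k‖ ≤ (2 * Real.pi * K) ^ l.length := by
  induction l with
  | nil => simp [derivMultiplier]
  | cons j l ih =>
      have hK0 : 0 ≤ K := (abs_nonneg _).trans (hk j)
      simp only [derivMultiplier, List.map_cons, List.prod_cons, List.length_cons, pow_succ] at ih ⊢
      -- `‖2πi kⱼ‖ = 2π |kⱼ|` is `Literature.Analysis.FunctionSpaces.Lattice.norm_two_pi_I_mul`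
      -- (LatticeSobolevDeriv); re-derived inline to keep the import cone small.
      have hf : ‖(2 * Real.pi * Complex.I * (k j) : ℂ)‖ = 2 * Real.pi * |(k j : ℝ)| := by
        simp [abs_of_pos Real.pi_pos]
      rw [norm_mul, hf, mul_comm]
      exact mul_le_mul ih (mul_le_mul_of_nonneg_left (hk j) (by positivity)) (by positivity)
        (by positivity)

namespace DyadicTrigPoly

section Semantics

variable [Fintype d]

/-- The `i`-th term. [folklore] -/
def term (P : DyadicTrigPoly d) (i : Fin P.terms.length) : TrigTerm d := P.terms.get i

/-- The finite set of frequencies occurring in `P`. [folklore] -/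
def freqs (P : DyadicTrigPoly d) : Finset (d → ℤ) := Finset.univ.image fun i => (P.term i).freq

/-- The aggregated complex coefficient family `c_k = 2^{-prec} ∑_{t : kₜ = k} (aₜ + bₜ i)`
(zero off `freqs`). [folklore] -/
def coeff (P : DyadicTrigPoly d) (k : d → ℤ) : ℂ :=
  (((2 : ℝ) ^ P.prec)⁻¹ : ℝ) *
    ∑ i ∈ Finset.univ.filter (fun i => (P.term i).freq = k), (P.term i).coeff

/-- **The function `V : T^d → ℝ` denoted by `P`**: the real trigonometric polynomial
`Re ∑_{k ∈ freqs} c_k e_k` of `TorusScalarTrigPoly` (Grafakos 2014, §3.1.1 for trigonometric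
polynomials on `T^d`). [folklore] -/
def toFun (P : DyadicTrigPoly d) : UnitAddTorus d → ℝ := Torus.reTrigPoly P.freqs P.coeff

/-- `V` is smooth on the torus. [folklore] -/
theorem isSmooth_toFun (P : DyadicTrigPoly d) : Torus.IsSmooth P.toFun :=
  Torus.isSmooth_reTrigPoly _ _

/-- `V` is continuous. [folklore] -/
theorem continuous_toFun (P : DyadicTrigPoly d) : Continuous P.toFun :=
  P.isSmooth_toFun.continuous

/-- Every term frequency lies in `freqs`. [folklore] -/
theorem mem_freqs (P : DyadicTrigPoly d) (i : Fin P.terms.length) : (P.term i).freq ∈ P.freqs :=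
  Finset.mem_image_of_mem _ (Finset.mem_univ i)

/-- **Term form of the semantics**: `V(x) = 2^{-prec} ∑ₜ Re(e_{kₜ}(x) (aₜ + bₜ i))`
(`= 2^{-prec} ∑ₜ (aₜ cos(2π kₜ·x) - bₜ sin(2π kₜ·x))`). [folklore] -/
theorem toFun_apply (P : DyadicTrigPoly d) (x : UnitAddTorus d) :
    P.toFun x = ((2 : ℝ) ^ P.prec)⁻¹ *
      ∑ i : Fin P.terms.length, (mFourier (P.term i).freq x * (P.term i).coeff).re := by
  rw [toFun, Torus.reTrigPoly_eq_sum, Finset.mul_sum]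
  simp only [coeff]
  rw [← Finset.sum_fiberwise_of_maps_to (g := fun i => (P.term i).freq) (fun i _ => P.mem_freqs i)]
  refine Finset.sum_congr rfl fun k _ => ?_
  rw [← mul_assoc, mul_comm (mFourier k x), mul_assoc, Complex.re_ofReal_mul, Finset.mul_sum,
    Complex.re_sum, Finset.mul_sum]
  refine Finset.sum_congr rfl fun i hi => ?_
  rw [(Finset.mem_filter.1 hi).2]

/-- The empty term list denotes the zero potential (no junk). [folklore] -/
theorem toFun_nil (prec : ℕ) : (⟨prec, []⟩ : DyadicTrigPoly d).toFun = 0 := by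
  funext x
  rw [toFun_apply]
  simp

/-- **Sup bound for real trigonometric polynomials**: `|Re ∑_{k∈S} c_k e_k(x)| ≤ ∑_{k∈S} ‖c_k‖`
(`|e_k| = 1`). [folklore] -/
theorem abs_reTrigPoly_le (S : Finset (d → ℤ)) (c : (d → ℤ) → ℂ) (x : UnitAddTorus d) :
    |Torus.reTrigPoly S c x| ≤ ∑ k ∈ S, ‖c k‖ := by
  rw [Torus.reTrigPoly_eq_sum]
  refine (Finset.abs_sum_le_sum_abs _ _).trans (Finset.sum_le_sum fun k _ => ?_)
  refine (Complex.abs_re_le_norm _).trans ?_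
  have h1 : ‖mFourier k x‖ = 1 := by simp [mFourier]
  rw [norm_mul, h1, one_mul]

/-- The **`ℓ¹` height** `2^{-prec} ∑ₜ (|aₜ| + |bₜ|)` of the syntax — the constant of the explicit
`C^k` bounds (`hasDerivBounds_toFun`). [folklore] -/
def l1Bound (P : DyadicTrigPoly d) : ℝ :=
  ((2 : ℝ) ^ P.prec)⁻¹ * ∑ i : Fin P.terms.length, (|((P.term i).re : ℝ)| + |((P.term i).im : ℝ)|)

/-- The **largest frequency** `maxₜ ‖kₜ‖_∞ ∈ ℕ` of the syntax (`0` for the empty list).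
[folklore] -/
def freqSup (P : DyadicTrigPoly d) : ℕ :=
  Finset.univ.sup fun i : Fin P.terms.length => (P.term i).freqSup

omit [Fintype d] in
/-- `0 ≤ l1Bound`. [folklore] -/
theorem l1Bound_nonneg (P : DyadicTrigPoly d) : 0 ≤ P.l1Bound :=
  mul_nonneg (by positivity) (Finset.sum_nonneg fun _ _ => by positivity)

/-- Frequencies of `P` have coordinates bounded by `freqSup`. [folklore] -/
theorem abs_apply_le_freqSup (P : DyadicTrigPoly d) {k : d → ℤ} (hk : k ∈ P.freqs) (j : d) :
    |(k j : ℝ)| ≤ P.freqSup := by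
  obtain ⟨i, -, rfl⟩ := Finset.mem_image.1 hk
  refine ((P.term i).abs_freq_le_freqSup j).trans ?_
  exact_mod_cast Finset.le_sup (f := fun i : Fin P.terms.length => (P.term i).freqSup)
    (Finset.mem_univ i)

/-- The aggregated coefficients have `ℓ¹` mass at most `l1Bound`. [folklore] -/
theorem sum_norm_coeff_le (P : DyadicTrigPoly d) : ∑ k ∈ P.freqs, ‖P.coeff k‖ ≤ P.l1Bound := by
  have h2 : 0 ≤ ((2 : ℝ) ^ P.prec)⁻¹ := by positivity
  calc ∑ k ∈ P.freqs, ‖P.coeff k‖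
      ≤ ∑ k ∈ P.freqs, ((2 : ℝ) ^ P.prec)⁻¹ *
          ∑ i ∈ Finset.univ.filter (fun i => (P.term i).freq = k), ‖(P.term i).coeff‖ := by
        refine Finset.sum_le_sum fun k _ => ?_
        rw [coeff, norm_mul, Complex.norm_real, Real.norm_of_nonneg h2]
        exact mul_le_mul_of_nonneg_left (norm_sum_le _ _) h2
    _ = ((2 : ℝ) ^ P.prec)⁻¹ * ∑ i, ‖(P.term i).coeff‖ := by
        rw [← Finset.mul_sum, Finset.sum_fiberwise_of_maps_to (fun i _ => P.mem_freqs i)]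
    _ ≤ P.l1Bound :=
        mul_le_mul_of_nonneg_left (Finset.sum_le_sum fun i _ => (P.term i).norm_coeff_le) h2

end Semantics

section Derivatives

variable [Fintype d] [DecidableEq d]

/-- The **syntactic partial derivative** `∂ⱼV`: the real trigonometric polynomial with
coefficients `2πi kⱼ c_k` (Grafakos 2014, proof of Prop. 3.2.6 (8): `∂ⱼ e_k = 2πi kⱼ e_k`). It IS
the torus partial derivative of `V` (`partialDeriv_toFun`). [folklore] -/
def partialFun (P : DyadicTrigPoly d) (j : d) : UnitAddTorus d → ℝ :=
  Torus.reTrigPoly P.freqs fun k => (2 * Real.pi * Complex.I * (k j)) • P.coeff k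

/-- The **syntactic gradient** `∇V(x) = (∂ⱼV(x))ⱼ ∈ ℝ^d`. [folklore] -/
def gradFun (P : DyadicTrigPoly d) (x : UnitAddTorus d) : EuclideanSpace ℝ d :=
  WithLp.toLp 2 fun j => P.partialFun j x

/-- `∂ⱼ V = partialFun P j` (the torus partial derivative of `TorusCalculus`). [folklore] -/
theorem partialDeriv_toFun (P : DyadicTrigPoly d) (j : d) (x : UnitAddTorus d) :
    Torus.partialDeriv j P.toFun x = P.partialFun j x :=
  Torus.partialDeriv_reTrigPoly _ _ j x

/-- `(∇V(x))ⱼ = partialFun P j x`. [folklore] -/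
theorem gradient_toFun_apply (P : DyadicTrigPoly d) (x : UnitAddTorus d) (j : d) :
    Torus.gradient P.toFun x j = P.partialFun j x := by
  rw [toFun, Torus.gradient_reTrigPoly_apply]
  exact P.partialDeriv_toFun j x

/-- **The torus gradient of `V` is the syntactic gradient**: `∇V = gradFun P`. [folklore] -/
theorem gradient_toFun (P : DyadicTrigPoly d) (x : UnitAddTorus d) :
    Torus.gradient P.toFun x = P.gradFun x := by
  ext j
  rw [gradient_toFun_apply]
  rfl

/-- `∇V` is smooth. [folklore] -/
theorem isSmooth_gradFun (P : DyadicTrigPoly d) : Torus.IsSmooth P.gradFun := by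
  have h : P.gradFun = Torus.gradient P.toFun := funext fun x => (P.gradient_toFun x).symm
  rw [h]
  exact P.isSmooth_toFun.gradient

/-- `∇V` is continuous. [folklore] -/
theorem continuous_gradFun (P : DyadicTrigPoly d) : Continuous P.gradFun :=
  P.isSmooth_gradFun.continuous

/-- **Iterated partial derivatives act diagonally on real trigonometric polynomials**:
`∂^l Re ∑ c_k e_k = Re ∑ (∏_{j∈l} 2πi kⱼ) c_k e_k`. [folklore] -/
theorem iterPartialDeriv_reTrigPoly (l : List d) (S : Finset (d → ℤ)) (c : (d → ℤ) → ℂ) :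
    Torus.iterPartialDeriv l (Torus.reTrigPoly S c) =
      Torus.reTrigPoly S (fun k => derivMultiplier l k • c k) := by
  induction l generalizing c with
  | nil => simp [derivMultiplier]
  | cons j l ih =>
      rw [Torus.iterPartialDeriv_cons, ih]
      funext x
      rw [Torus.partialDeriv_reTrigPoly]
      congr 1
      funext k
      simp only [derivMultiplier, List.map_cons, List.prod_cons, smul_smul]

/-- **Explicit `C^k` bounds for real trigonometric polynomials**: if every frequency in `S` has
`‖k‖_∞ ≤ K` then `‖∂^α Re ∑_{k∈S} c_k e_k‖_∞ ≤ (∑_{k∈S} ‖c_k‖) (2πK)^{|α|}` for all `α`, i.e.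
`Torus.HasDerivBounds n _ (∑ ‖c_k‖) (2πK)` for every `n` (Bernstein-type bookkeeping, "each
derivative costs a factor `2π ×` frequency"). [folklore] -/
theorem hasDerivBounds_reTrigPoly (S : Finset (d → ℤ)) (c : (d → ℤ) → ℂ) {K : ℝ}
    (hK : ∀ k ∈ S, ∀ j, |(k j : ℝ)| ≤ K) (n : ℕ) :
    Torus.HasDerivBounds n (Torus.reTrigPoly S c) (∑ k ∈ S, ‖c k‖) (2 * Real.pi * K) := by
  refine ⟨Torus.isSmooth_reTrigPoly S c, fun l _ y => ?_⟩
  rw [iterPartialDeriv_reTrigPoly, Real.norm_eq_abs]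
  refine (abs_reTrigPoly_le _ _ y).trans ?_
  rw [Finset.sum_mul]
  refine Finset.sum_le_sum fun k hk => ?_
  rw [norm_smul, mul_comm]
  exact mul_le_mul_of_nonneg_left (norm_derivMultiplier_le (hK k hk) l) (norm_nonneg _)

/-- **The explicit `C^k` bound of a dyadic trigonometric polynomial**, read off its syntax:
`‖∂^α V‖_∞ ≤ l1Bound · (2π freqSup)^{|α|}` for all multi-indices `α` (every order `n`).
[folklore] -/
theorem hasDerivBounds_toFun (P : DyadicTrigPoly d) (n : ℕ) :
    Torus.HasDerivBounds n P.toFun P.l1Bound (2 * Real.pi * P.freqSup) :=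
  (hasDerivBounds_reTrigPoly P.freqs P.coeff (fun _ hk j => P.abs_apply_le_freqSup hk j) n).mono
    P.sum_norm_coeff_le (by positivity) le_rfl

/-- Order-zero read-out: `|V(x)| ≤ l1Bound`. [folklore] -/
theorem abs_toFun_le (P : DyadicTrigPoly d) (x : UnitAddTorus d) : |P.toFun x| ≤ P.l1Bound := by
  have h := (P.hasDerivBounds_toFun 0).norm_le x
  rwa [Real.norm_eq_abs] at h

/-- First-order read-out (the `C¹` bound): `|∂ⱼV(x)| ≤ l1Bound · 2π freqSup`. [folklore] -/
theorem abs_partialFun_le (P : DyadicTrigPoly d) (j : d) (x : UnitAddTorus d) :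
    |P.partialFun j x| ≤ P.l1Bound * (2 * Real.pi * P.freqSup) := by
  have h := (P.hasDerivBounds_toFun 1).norm_partialDeriv_le le_rfl j x
  rwa [partialDeriv_toFun, Real.norm_eq_abs] at h

/-- Second-order read-out (the **`C²` bound**): `|∂ᵢ∂ⱼV(x)| ≤ l1Bound · (2π freqSup)²`.
[folklore] -/
theorem abs_partialDeriv_partialFun_le (P : DyadicTrigPoly d) (i j : d) (x : UnitAddTorus d) :
    |Torus.partialDeriv i (P.partialFun j) x| ≤ P.l1Bound * (2 * Real.pi * P.freqSup) ^ 2 := by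
  have h := (P.hasDerivBounds_toFun 2).bound (l := [i, j]) le_rfl x
  have h2 : Torus.partialDeriv j P.toFun = P.partialFun j := funext (P.partialDeriv_toFun j)
  simpa [h2, Real.norm_eq_abs] using h

end Derivatives

end DyadicTrigPoly

/-! ## Phase space and shear rounds -/

/-- The **phase space** `T^{2n} = T^n × T^n ∋ (x, y)` (positions, momenta), `T^n = UnitAddTorus d`.
Its norm is the sup of the quotient norms of the `2n` coordinates in `ℝ/ℤ`
(`‖(t : ℝ/ℤ)‖ = dist(t, ℤ)`, Mathlib `AddCircle.norm_eq`), i.e. the flat `|·|_∞` metric.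
[folklore] -/
abbrev Phase (d : Type*) := UnitAddTorus d × UnitAddTorus d

/-- A **shear round**: `kick V` is the map `(x, y) ↦ (x, y + ∇V(x))` (momenta kicked by the
force of the potential `-V`), `drift W` the map `(x, y) ↦ (x + ∇W(y), y)` (positions drift with
the velocity of the kinetic term `W`) — the exact time-one flows of the Hamiltonians
`H(x, y) = -V(x)` resp. `H(x, y) = W(y)` ([HairerWannerLubich2002], §II.5 (5.4)–(5.5)), with
dyadic trigonometric polynomial potentials.
[cite: HairerWannerLubich2002, §II.5 Example 5.1 (5.4)–(5.5)] -/
inductive ShearRound (d : Type*)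
  /-- `(x, y) ↦ (x, y + ∇V(x))`. -/
  | kick (V : DyadicTrigPoly d)
  /-- `(x, y) ↦ (x + ∇W(y), y)`. -/
  | drift (W : DyadicTrigPoly d)

namespace ShearRound

variable [Fintype d]

/-- The torus gradient of a constant vanishes. [folklore] -/
theorem gradient_const (c : ℝ) (x : UnitAddTorus d) :
    Torus.gradient (fun _ : UnitAddTorus d => c) x = 0 := by
  have h : Torus.liftAt (fun _ : UnitAddTorus d => c) x = fun _ => c :=
    funext fun v => Torus.liftAt_apply _ _ v
  simp [Torus.gradient, _root_.gradient, h]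

/-- The potential of a round (`V` or `W`). [folklore] -/
def potential : ShearRound d → DyadicTrigPoly d
  | kick V => V
  | drift W => W

/-- **The map of a round** on `T^{2n}`: `kick V (x, y) = (x, y + ∇V(x))`,
`drift W (x, y) = (x + ∇W(y), y)`; the real vector `∇V(x) ∈ ℝ^n` (the torus gradient
`Torus.gradient`) acts on `T^n` through the covering map `Torus.proj : ℝ^n → T^n`.
[cite: HairerWannerLubich2002, §II.5 Example 5.1 (5.5)] -/
def toMap : ShearRound d → Phase d → Phase d
  | kick V => fun z => (z.1, z.2 + Torus.proj (Torus.gradient V.toFun z.1))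
  | drift W => fun z => (z.1 + Torus.proj (Torus.gradient W.toFun z.2), z.2)

/-- The inverse round (the opposite shear). [folklore] -/
def invMap : ShearRound d → Phase d → Phase d
  | kick V => fun z => (z.1, z.2 - Torus.proj (Torus.gradient V.toFun z.1))
  | drift W => fun z => (z.1 - Torus.proj (Torus.gradient W.toFun z.2), z.2)

/-- `kick V (x, y) = (x, y + ∇V(x))`. [folklore] -/
@[simp] theorem toMap_kick (V : DyadicTrigPoly d) (z : Phase d) :
    (kick V).toMap z = (z.1, z.2 + Torus.proj (Torus.gradient V.toFun z.1)) := rfl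

/-- `drift W (x, y) = (x + ∇W(y), y)`. [folklore] -/
@[simp] theorem toMap_drift (W : DyadicTrigPoly d) (z : Phase d) :
    (drift W).toMap z = (z.1 + Torus.proj (Torus.gradient W.toFun z.2), z.2) := rfl

/-- **A shear round is a bijection of `T^{2n}`** with inverse the opposite shear. [folklore] -/
def toEquiv (r : ShearRound d) : Phase d ≃ Phase d where
  toFun := r.toMap
  invFun := r.invMap
  left_inv z := by cases r <;> simp [toMap, invMap]
  right_inv z := by cases r <;> simp [toMap, invMap]

/-- The underlying map of `toEquiv`. [folklore] -/
@[simp] theorem coe_toEquiv (r : ShearRound d) : ⇑r.toEquiv = r.toMap := rfl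

/-- Shear rounds are continuous. [folklore] -/
theorem continuous_toMap : ∀ r : ShearRound d, Continuous r.toMap
  | kick V => continuous_fst.prodMk (continuous_snd.add
      ((Torus.continuous_proj.comp V.isSmooth_toFun.gradient.continuous).comp continuous_fst))
  | drift W => (continuous_fst.add ((Torus.continuous_proj.comp
      W.isSmooth_toFun.gradient.continuous).comp continuous_snd)).prodMk continuous_snd

/-- A round with the zero potential (empty term list) is the identity (no junk). [folklore] -/
theorem toMap_kick_nil (prec : ℕ) (z : Phase d) :
    (kick (⟨prec, []⟩ : DyadicTrigPoly d)).toMap z = z := by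
  rw [toMap_kick, DyadicTrigPoly.toFun_nil]
  have h : Torus.gradient (0 : UnitAddTorus d → ℝ) z.1 = 0 := gradient_const 0 z.1
  rw [h, Torus.proj_zero, add_zero]

/-- **The lift of a round to the universal cover** `ℝ^n × ℝ^n`:
`(u, v) ↦ (u, v + ∇V(proj u))` resp. `(u + ∇W(proj v), v)` — of the form `id + (periodic)`,
as every lift of a torus map homotopic to the identity ([McDuffSalamon2017], proof of
Lemma 11.1.1: `ψ(x, y) = (x + p(x, y), y + q(x, y))`).
[cite: McDuffSalamon2017, Lemma 11.1.1 (proof)] -/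
def liftMap : ShearRound d → EuclideanSpace ℝ d × EuclideanSpace ℝ d →
    EuclideanSpace ℝ d × EuclideanSpace ℝ d
  | kick V => fun w => (w.1, w.2 + Torus.gradient V.toFun (Torus.proj w.1))
  | drift W => fun w => (w.1 + Torus.gradient W.toFun (Torus.proj w.2), w.2)

/-- The lift covers the round: `proj ∘ liftMap = toMap ∘ proj`. [folklore] -/
theorem proj_liftMap (r : ShearRound d) (w : EuclideanSpace ℝ d × EuclideanSpace ℝ d) :
    Prod.map Torus.proj Torus.proj (r.liftMap w) = r.toMap (Prod.map Torus.proj Torus.proj w) := by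
  cases r <;> simp [liftMap, toMap]

/-- The lift commutes with the deck translations by `ℤ^n × ℤ^n`:
`liftMap (u + k, v + l) = liftMap (u, v) + (k, l)`. [folklore] -/
theorem liftMap_add_latticeVec [DecidableEq d] (r : ShearRound d)
    (w : EuclideanSpace ℝ d × EuclideanSpace ℝ d) (k l : d → ℤ) :
    r.liftMap (w.1 + Torus.latticeVec k, w.2 + Torus.latticeVec l) =
      r.liftMap w + (Torus.latticeVec k, Torus.latticeVec l) := by
  cases r <;> simp [liftMap, add_right_comm]

/-- **The generating function of type V of a round** ([McDuffSalamon2017], Lemma 9.2.1), as a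
function `S(x₁, y₀)` of the NEW position and the OLD momentum, on `T^n × T^n`:
`S = -V(x₁)` for `kick V`, `S = W(y₀)` for `drift W`. [cite: McDuffSalamon2017, Lemma 9.2.1] -/
def genFun : ShearRound d → UnitAddTorus d → UnitAddTorus d → ℝ
  | kick V => fun x₁ _ => -V.toFun x₁
  | drift W => fun _ y₀ => W.toFun y₀

/-- The torus gradient of `-V`. [folklore] -/
theorem gradient_neg_toFun [DecidableEq d] (V : DyadicTrigPoly d) (x : UnitAddTorus d) :
    Torus.gradient (fun y => -V.toFun y) x = -Torus.gradient V.toFun x := by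
  have h := Torus.gradient_fun_const_mul (V.isSmooth_toFun.isContDiff (by simp)) (-1) x
  simp only [neg_mul, one_mul, neg_smul, one_smul] at h
  exact h

/-- **Hamiltonian difference equations, first half** ([McDuffSalamon2017], (9.2.3)/(11.1.4)):
on the universal cover, `x₁ - x₀ = ∂S/∂y (x₁, y₀)` for `(x₁, y₁) = liftMap (x₀, y₀)`.
[cite: McDuffSalamon2017, Lemma 9.2.1 and (9.2.3)] -/
theorem liftMap_fst_sub [DecidableEq d] (r : ShearRound d)
    (w : EuclideanSpace ℝ d × EuclideanSpace ℝ d) :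
    (r.liftMap w).1 - w.1 =
      Torus.gradient (r.genFun (Torus.proj (r.liftMap w).1)) (Torus.proj w.2) := by
  cases r with
  | kick V => simp [liftMap, genFun, gradient_const]
  | drift W => simp [liftMap, genFun]

/-- **Hamiltonian difference equations, second half** ([McDuffSalamon2017], (9.2.3)/(11.1.4)):
`y₁ - y₀ = -∂S/∂x (x₁, y₀)` for `(x₁, y₁) = liftMap (x₀, y₀)`. Hence the fixed points of a
composition of rounds are the critical points of the discrete symplectic action
`Φ(z) = ∑ⱼ (⟨yⱼ, xⱼ₊₁ - xⱼ⟩ - Sⱼ(xⱼ₊₁, yⱼ))` on periodic sequences ([McDuffSalamon2017],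
(9.2.4), Lemma 9.2.6) — not formalised here. [cite: McDuffSalamon2017, Lemma 9.2.1 and (9.2.3)] -/
theorem liftMap_snd_sub [DecidableEq d] (r : ShearRound d)
    (w : EuclideanSpace ℝ d × EuclideanSpace ℝ d) :
    (r.liftMap w).2 - w.2 =
      -Torus.gradient (fun x => r.genFun x (Torus.proj w.2)) (Torus.proj (r.liftMap w).1) := by
  cases r with
  | kick V => simp [liftMap, genFun, gradient_neg_toFun]
  | drift W => simp [liftMap, genFun, gradient_const]

/-! ### Compositions of rounds (lists, head applied first) -/

/-- The composed map of a list of rounds, the head acting first: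
`comp [r₀, …, r_{m-1}] = r_{m-1} ∘ ⋯ ∘ r₀`. [folklore] -/
def comp : List (ShearRound d) → Phase d → Phase d
  | [] => id
  | r :: rs => comp rs ∘ r.toMap

/-- `comp [] = id`. [folklore] -/
@[simp] theorem comp_nil : comp ([] : List (ShearRound d)) = id := rfl

/-- `comp (r :: rs) = comp rs ∘ r`. [folklore] -/
@[simp] theorem comp_cons (r : ShearRound d) (rs : List (ShearRound d)) :
    comp (r :: rs) = comp rs ∘ r.toMap := rfl

/-- `comp (rs ++ rs') = comp rs' ∘ comp rs`. [folklore] -/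
theorem comp_append (rs rs' : List (ShearRound d)) : comp (rs ++ rs') = comp rs' ∘ comp rs := by
  induction rs with
  | nil => rfl
  | cons r rs ih => rw [List.cons_append, comp_cons, comp_cons, ih]; rfl

/-- The composed bijection of a list of rounds. [folklore] -/
def compEquiv : List (ShearRound d) → Phase d ≃ Phase d
  | [] => Equiv.refl _
  | r :: rs => r.toEquiv.trans (compEquiv rs)

/-- `compEquiv` has underlying map `comp`. [folklore] -/
@[simp] theorem coe_compEquiv : ∀ rs : List (ShearRound d), ⇑(compEquiv rs) = comp rs
  | [] => rfl
  | r :: rs => by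
      funext z
      simp [compEquiv, coe_compEquiv rs]

/-- Compositions of rounds are continuous. [folklore] -/
theorem continuous_comp : ∀ rs : List (ShearRound d), Continuous (comp rs)
  | [] => continuous_id
  | r :: rs => (continuous_comp rs).comp r.continuous_toMap

end ShearRound

/-! ## Hamiltonian shear compositions -/

/-- A **Hamiltonian shear composition** ("gradient-Feistel circuit") on `T^{2n}`: a finite list
of shear rounds `kick V` / `drift W` with dyadic trigonometric polynomial potentials, denoting
the composed map `HamShearComposition.toMap` (head of the list applied first) — a general
splitting-type composition of exact Hamiltonian shear flows ([HairerWannerLubich2002], §II.5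
(5.6)); a composition of Hamiltonian symplectomorphisms of the standard `T^{2n}`, to which the
Conley–Zehnder theorem ([McDuffSalamon2017], Thm. 11.1.9) applies. Interface only: nothing here
asserts the existence of fixed points. [cite: HairerWannerLubich2002, §II.5 Example 5.1 (5.6)] -/
structure HamShearComposition (d : Type*) where
  /-- The rounds, in the order in which they are applied. -/
  rounds : List (ShearRound d)

namespace HamShearComposition

variable [Fintype d]

/-- **The map `F : T^{2n} → T^{2n}`** of a shear composition (rounds applied in list order).
[folklore] -/
def toMap (F : HamShearComposition d) : Phase d → Phase d := ShearRound.comp F.rounds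

/-- `F` as a bijection of `T^{2n}`. [folklore] -/
def toEquiv (F : HamShearComposition d) : Phase d ≃ Phase d := ShearRound.compEquiv F.rounds

/-- The underlying map of `toEquiv` is `toMap`. [folklore] -/
@[simp] theorem coe_toEquiv (F : HamShearComposition d) : ⇑F.toEquiv = F.toMap :=
  ShearRound.coe_compEquiv _

/-- `F` is a bijection. [folklore] -/
theorem bijective_toMap (F : HamShearComposition d) : Function.Bijective F.toMap := by
  rw [← coe_toEquiv]; exact F.toEquiv.bijective

/-- `F` is continuous. [folklore] -/
theorem continuous_toMap (F : HamShearComposition d) : Continuous F.toMap :=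
  ShearRound.continuous_comp _

/-- The empty circuit is the identity. [folklore] -/
@[simp] theorem toMap_nil : (⟨[]⟩ : HamShearComposition d).toMap = id := rfl

/-- Prepending a round: it acts first. [folklore] -/
@[simp] theorem toMap_cons (r : ShearRound d) (rs : List (ShearRound d)) :
    (⟨r :: rs⟩ : HamShearComposition d).toMap = (⟨rs⟩ : HamShearComposition d).toMap ∘ r.toMap :=
  rfl

/-- Concatenation of circuits is composition of maps (first list first). [folklore] -/
theorem toMap_append (F G : HamShearComposition d) :
    (⟨F.rounds ++ G.rounds⟩ : HamShearComposition d).toMap = G.toMap ∘ F.toMap :=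
  ShearRound.comp_append _ _

end HamShearComposition

/-! ## Dyadic grids and `ε`-fixed-point instances -/

/-- The dyadic point `j / 2^q (mod 1)` of `T^n`, `j ∈ ℤ^n`. [folklore] -/
def dyadicPoint (q : ℕ) (j : d → ℤ) : UnitAddTorus d :=
  fun i => (((j i : ℝ) / 2 ^ q : ℝ) : UnitAddCircle)

/-- The **dyadic grid** `(2^{-q}ℤ/ℤ)^{2n} ⊆ T^{2n}` of resolution `q`. [folklore] -/
def dyadicGrid (q : ℕ) : Set (Phase d) :=
  Set.range fun jj : (d → ℤ) × (d → ℤ) => (dyadicPoint q jj.1, dyadicPoint q jj.2)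

/-- Grid points are in the grid. [folklore] -/
theorem mk_mem_dyadicGrid (q : ℕ) (j j' : d → ℤ) :
    (dyadicPoint q j, dyadicPoint q j') ∈ (dyadicGrid q : Set (Phase d)) :=
  ⟨(j, j'), rfl⟩

/-- `dyadicPoint q 0 = 0`. [folklore] -/
@[simp] theorem dyadicPoint_zero (q : ℕ) : dyadicPoint q (0 : d → ℤ) = 0 := by
  funext i; simp [dyadicPoint]

/-- The origin is a grid point at every resolution. [folklore] -/
theorem zero_mem_dyadicGrid (q : ℕ) : (0 : Phase d) ∈ (dyadicGrid q : Set (Phase d)) := by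
  refine ⟨(0, 0), ?_⟩
  simp only [dyadicPoint_zero]
  rfl

/-- The grid is `2^q`-periodic in the labels: `dyadicPoint q (j + 2^q m) = dyadicPoint q j`, so
`dyadicGrid q` is the image of the finite set `(ℤ/2^q)^{2n}`. [folklore] -/
theorem dyadicPoint_add_mul (q : ℕ) (j m : d → ℤ) :
    dyadicPoint q (fun i => j i + 2 ^ q * m i) = dyadicPoint q j := by
  funext i
  have hm : (((m i : ℤ) : ℝ) : UnitAddCircle) = 0 :=
    (AddCircle.coe_eq_zero_iff (1 : ℝ)).2 ⟨m i, by simp⟩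
  simp only [dyadicPoint]
  rw [Int.cast_add, add_div, Int.cast_mul, Int.cast_pow, Int.cast_ofNat,
    mul_div_cancel_left₀ _ (by positivity), AddCircle.coe_add, hm, add_zero]

/-- An **Arnold-torus instance**: a shear composition (the circuit computing `F`) together with
an accuracy exponent `p`, `ε = 2^{-p}`. The associated total search problem — "find a dyadic
grid point `z` with `|F z - z|_∞ ≤ ε`" — is `IsSolution`; its totality for a suitable
`q = poly(instance)` rests on the Conley–Zehnder theorem ([McDuffSalamon2017], Thm. 11.1.9) plus
the Lipschitz bounds of `DyadicTrigPoly.hasDerivBounds_toFun`, and is deliberately NOT part of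
this structure (nor is any hardness claim). [folklore] -/
structure ArnoldTorusInstance (d : Type*) where
  /-- The shear circuit computing `F : T^{2n} → T^{2n}`. -/
  circuit : HamShearComposition d
  /-- The accuracy exponent: `ε = 2^{-p}`. -/
  p : ℕ

namespace ArnoldTorusInstance

variable [Fintype d]

/-- The accuracy `ε = 2^{-p}`. [folklore] -/
def eps (I : ArnoldTorusInstance d) : ℝ := ((2 : ℝ) ^ I.p)⁻¹

omit [Fintype d] in
/-- `ε > 0`. [folklore] -/
theorem eps_pos (I : ArnoldTorusInstance d) : 0 < I.eps := by
  unfold eps; positivity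

/-- **`ε`-fixed point**: `|F z - z|_∞ ≤ ε` in the flat metric of `T^{2n}` (the norm of
`Phase d` is the sup over the `2n` coordinates of the distance to `ℤ`). [folklore] -/
def IsNearFixedPt (I : ArnoldTorusInstance d) (z : Phase d) : Prop :=
  ‖I.circuit.toMap z - z‖ ≤ I.eps

/-- **Solutions of the instance at grid resolution `q`**: dyadic grid points of `T^{2n}` that are
`ε`-fixed. (Which resolution `q`, polynomial in the instance size, is prescribed belongs to the
search-problem statement, not to this interface.) [folklore] -/
def IsSolution (I : ArnoldTorusInstance d) (q : ℕ) (z : Phase d) : Prop :=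
  z ∈ (dyadicGrid q : Set (Phase d)) ∧ I.IsNearFixedPt z

/-- Coordinatewise form: `z` is `ε`-fixed iff every one of the `2n` circle coordinates of
`F z - z` has norm `≤ ε`. [folklore] -/
theorem isNearFixedPt_iff (I : ArnoldTorusInstance d) (z : Phase d) :
    I.IsNearFixedPt z ↔ (∀ i, ‖(I.circuit.toMap z).1 i - z.1 i‖ ≤ I.eps) ∧
      ∀ i, ‖(I.circuit.toMap z).2 i - z.2 i‖ ≤ I.eps := by
  rw [IsNearFixedPt, Prod.norm_def, max_le_iff, pi_norm_le_iff_of_nonneg I.eps_pos.le,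
    pi_norm_le_iff_of_nonneg I.eps_pos.le]
  rfl

/-- Exact fixed points of `F` are `ε`-fixed for every accuracy. [folklore] -/
theorem isNearFixedPt_of_isFixedPt (I : ArnoldTorusInstance d) {z : Phase d}
    (h : Function.IsFixedPt I.circuit.toMap z) : I.IsNearFixedPt z := by
  rw [IsNearFixedPt, h.eq, sub_self, norm_zero]
  exact I.eps_pos.le

/-- An exact fixed point lying on the grid is a solution. [folklore] -/
theorem isSolution_of_isFixedPt (I : ArnoldTorusInstance d) {q : ℕ} {z : Phase d}
    (hz : z ∈ (dyadicGrid q : Set (Phase d))) (h : Function.IsFixedPt I.circuit.toMap z) :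
    I.IsSolution q z :=
  ⟨hz, I.isNearFixedPt_of_isFixedPt h⟩

/-- The empty circuit (the identity) is solved by the origin at every resolution — a sanity
check that the predicates are inhabited. [folklore] -/
theorem isSolution_nil_zero (p q : ℕ) :
    (⟨⟨[]⟩, p⟩ : ArnoldTorusInstance d).IsSolution q 0 :=
  isSolution_of_isFixedPt _ (zero_mem_dyadicGrid q) rfl

end ArnoldTorusInstance

end Literature.Dynamics.Hamiltonian
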